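import Summits.NavierStokesRegularity.NavierStokesRegularity.Theses.PalasekTowerBreakdown
import Summits.NavierStokesRegularity.FluidComputer.ForcedClassicalContinuation

/-!
# NavierStokesRegularity — route `PalasekTowerBreakdown`: the forced-era crossing of the child crux
# `HeredityAtOne` (and of every level) is a kernel consequence of ONE named fact — Tao's local
# `H¹` theory WITH forcing

Supports `stmt-NavierStokesRegularity-19249` (`PalasekTowerBreakdown.HeredityAtOne := HeredityAtOne`;
registered skeleton `Cruxes/HeredityAtOne/Lines/birth.lean`, stubs
`stub_continuation_envelope_one : ContinuationEnvelopeAt 1` / `stub_readout_floors_one : ReadoutFloorsAt 1`;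
the upper stub splits as `ContinuationEnvelopeAt 1 ↔ LocalContinuationAt 1 ∧ AprioriCeilingAt 1`,
`FluidComputer/PalasekTowerRegisterGlobalEnvelopeAt.lean`). Cell `ns-blowup`, seat
`ns-blowup-ecbridge-1` (g5). LABEL: E–C typing + kernel analysis (glue over the landed register and
the forced continuation theorem). WHAT THIS IS NOT: not NS — no stage, tower or instance is
constructed; the child crux is OPEN and not claimed; every theorem below carries the named fact
`Literature.Analysis.FluidPDE.tao2011_smooth_local_existence_forced` (Tao 2013, Thm. 5.4 (ii)+(iv)
WITH forcing — the forced twin of the DISCHARGED `tao2011_smooth_local_existence`) and/or the physics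
stubs as hypotheses.

`FluidComputer/ForcedClassicalContinuation.lean` proves: GIVEN that fact, a bounded classical
finite-energy solution of the forced system on a closed slab with Schwartz datum and Clay force
continues classically past the slab (restart loop: Tao's theorem from the `H^∞` slices, W14-free
uniqueness under the flow's own bound, forced Serrin–Grönwall at `r = ∞`, uniform lifespan, glue +
pressure re-gauge), hence `LocalContinuationAt k` for EVERY `k` (the registered stage carries its own
ceiling). Against the ROUTE DECL, by name:

* (`localContinuationAt_of_forced_local_existence : tao2011_smooth_local_existence_forced →
  ∀ k, LocalContinuationAt k` is the FluidComputer theorem itself, cited not restated: the «local»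
  stubs at `k = 0` and `k = 1` are a LITERATURE DEBT, no longer analysis left open in the route);
* `palasekTowerBreakdown_heredityAtOne_of_forced_apriori_floors :
  tao2011_smooth_local_existence_forced → AprioriCeilingAt 1 → ReadoutFloorsAt 1 →
  PalasekTowerBreakdown.HeredityAtOne` — the child crux BY NAME from the named fact and the two
  physics `∀`-bounds (no overshoot, floors);
* `palasekTowerBreakdown_continuationEnvelopeAt_one_of_forced_apriori` — the registered upper stub
  `ContinuationEnvelopeAt 1` from the named fact and `AprioriCeilingAt 1` alone.

References: T. Tao, Anal. PDE 6 (2013), Thm. 5.4 [cite: Tao2011, Thm. 5.4 (ii)+(iv)]; S. Palasek,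
arXiv:2605.13827 §4 [cite: Palasek2026ElementaryModel, §4]; P. G. Lemarié-Rieusset, CRC 2016,
Thm. 11.2 (11.11) [cite: LemarieRieusset2016, Thm. 11.2 (11.11)].
-/

-- `Summit.<Summit>.<Problem>` is the tree's mandated summit-side namespace (CONVENTIONS §2); for this
-- single-conjunct summit the two coincide, so the duplicate is deliberate.
set_option linter.dupNamespace false

namespace Summit.NavierStokesRegularity.NavierStokesRegularity.Theorems

open Summit.NavierStokesRegularity.NavierStokesRegularity.Theses
open Summit.NavierStokesRegularity.FluidComputer.PalasekTowerClayBridge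
open Literature.Analysis.FluidPDE

/-- **The registered upper stub of item 19249 modulo the named fact is the no-overshoot bet alone**:
`tao2011_smooth_local_existence_forced → AprioriCeilingAt 1 → ContinuationEnvelopeAt 1`.
[cite: Palasek2026ElementaryModel, §4] -/
theorem palasekTowerBreakdown_continuationEnvelopeAt_one_of_forced_apriori
    (hF : tao2011_smooth_local_existence_forced) (hA : AprioriCeilingAt 1) :
    ContinuationEnvelopeAt 1 :=
  continuationEnvelopeAt_of_forced_apriori hF le_rfl hA

/-- **The child crux BY NAME, modulo the named fact and the two physics stubs**:
`tao2011_smooth_local_existence_forced → AprioriCeilingAt 1 → ReadoutFloorsAt 1 →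
PalasekTowerBreakdown.HeredityAtOne`. [cite: Palasek2026ElementaryModel, §4] -/
theorem palasekTowerBreakdown_heredityAtOne_of_forced_apriori_floors
    (hF : tao2011_smooth_local_existence_forced) (hA : AprioriCeilingAt 1) (hR : ReadoutFloorsAt 1) :
    PalasekTowerBreakdown.HeredityAtOne :=
  heredityAtOne_of_forced_apriori_floors hF hA hR

/-- **Every registered stage of the route's register crosses the end of its slab under the design
force**, GIVEN the named fact (unit viscosity, wide rates, route margins; any schedule, any level).
[cite: Tao2011, Thm. 5.4 (ii)+(iv)] -/
theorem palasekTowerBreakdown_stage_exists_forced_continuation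
    (hF : tao2011_smooth_local_existence_forced) {S : Schedule TowerRates.wide} {k : ℕ}
    (s : Stage 1 TowerRates.wide S (Margins.routeG TowerRates.wide) k) :
    ∃ T' : ℝ, S.τ k < T' ∧
      ∃ (U : ℝ → EuclideanSpace ℝ (Fin 3) → EuclideanSpace ℝ (Fin 3))
        (P : ℝ → EuclideanSpace ℝ (Fin 3) → ℝ),
        IsClassicalNSSolutionOn (Set.Icc 0 T') 1 S.f U P ∧
        (∀ t ∈ Set.Icc 0 (S.τ k), U t = s.u t ∧ P t = s.p t) ∧
        (∃ C : ENNReal, C < ⊤ ∧ ∀ t ∈ Set.Icc 0 T', ∫⁻ x, ‖U t x‖ₑ ^ 2 ≤ C) :=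
  s.exists_forced_continuation hF one_pos

end Summit.NavierStokesRegularity.NavierStokesRegularity.Theorems
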